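import Mathlib.MeasureTheory.Function.LocallyIntegrable
import Mathlib.MeasureTheory.Integral.Bochner.Set
import Mathlib.Analysis.SpecialFunctions.Log.Basic
import Mathlib.Analysis.SpecificLimits.Basic
import HarnessLib

/-!
# The elementary Laplace method: `(1/n) log ∫_K gⁿ w → log max_K g`

Topic `Literature/Analysis/Asymptotics`. Everything here is PROVED from Mathlib (no definitions, no
named facts). The crudest — exponential-rate — form of Laplace's asymptotic method, which is what
irrationality and linear-independence proofs of Beukers / Rhin–Viola / Viola–Zudilin type consume for
their REAL multiple integrals (e.g. Viola–Zudilin 2018, (4.12): "Inside the unit square the integrand is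
positive with one stationary point, and vanishes on the boundary. Then the desired
`lim (1/n) log |J_z^{(0)}|` is obtained by Laplace's elementary asymptotic method"):

**Theorem** (`tendsto_log_setIntegral_pow_mul_div`). Let `K` be a compact measurable subset of a
topological measure space `(X, μ)` (finite on compacts), `g, w : X → ℝ` continuous on `K` with `g ≥ 0` and
`w > 0` on `K`, and let `x₀ ∈ K` be a maximum point of `g` on `K` with `g(x₀) > 0` such that every open
neighbourhood `U` of `x₀` has `μ(U ∩ K) > 0` (e.g. `x₀` an interior point of `K ⊆ ℝ^d`). Then
`∫_K gⁿ w dμ > 0` for all `n` and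

  `(1/n) · log ∫_K g(x)ⁿ w(x) dμ(x) ⟶ log g(x₀) = log max_K g`   (`n → ∞`).

Proof: `∫_K gⁿ w ≤ (max g)ⁿ ∫_K w` gives `limsup ≤ log max g`; for `c < max g`, `g > c` on `U ∩ K` for an
open `U ∋ x₀`, so `∫_K gⁿ w ≥ cⁿ · (min_K w) · μ(U ∩ K)` gives `liminf ≥ log c`.

## References

* N. G. de Bruijn, *Asymptotic Methods in Analysis*, North-Holland 1958 / Dover 1981, Ch. 4 (the Laplace
  method), §4.1–4.2.
* C. Viola, W. Zudilin, *Linear independence of dilogarithmic values*, J. reine angew. Math. 736 (2018),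
  §4.1, (4.12). [ViolaZudilin2018]
-/

noncomputable section

namespace Literature.Analysis.Asymptotics

open _root_.MeasureTheory _root_.Filter _root_.Topology _root_.Set

section LaplaceSupNorm

variable {X : Type*} [TopologicalSpace X] [MeasurableSpace X] [OpensMeasurableSpace X]
  {μ : Measure X} [IsFiniteMeasureOnCompacts μ] {K : Set X} {g w : X → ℝ} {x₀ : X}

/-- **Lower bound of the elementary Laplace method.** Under the hypotheses of
`tendsto_log_setIntegral_pow_mul_div`, for every `0 < c < g(x₀)` there is a constant `C > 0` with
`C · cⁿ ≤ ∫_K gⁿ w dμ` for all `n` (`C = min_K w · μ(U ∩ K)` for an open `U ∋ x₀` on which `g > c`).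
[folklore] -/
theorem exists_pos_mul_pow_le_setIntegral_pow_mul (hK : IsCompact K) (hKm : MeasurableSet K)
    (hg : ContinuousOn g K) (hw : ContinuousOn w K) (hg0 : ∀ x ∈ K, 0 ≤ g x) (hw0 : ∀ x ∈ K, 0 < w x)
    (hx₀ : x₀ ∈ K) (hfat : ∀ U : Set X, IsOpen U → x₀ ∈ U → 0 < μ (U ∩ K)) {c : ℝ} (hc : 0 < c)
    (hcM : c < g x₀) :
    ∃ C : ℝ, 0 < C ∧ ∀ n : ℕ, C * c ^ n ≤ ∫ x in K, g x ^ n * w x ∂μ := by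
  -- positive minimum `m` of `w` on `K`
  obtain ⟨xm, hxmK, hmin⟩ := hK.exists_isMinOn ⟨x₀, hx₀⟩ hw
  set m := w xm with hm
  have hm0 : 0 < m := hw0 xm hxmK
  -- an open `U ∋ x₀` with `g > c` on `U ∩ K`
  have hnhds : g ⁻¹' Ioi c ∈ 𝓝[K] x₀ := (hg x₀ hx₀).preimage_mem_nhdsWithin (Ioi_mem_nhds hcM)
  obtain ⟨U, hUo, hxU, hUK⟩ := mem_nhdsWithin.1 hnhds
  have hUKm : MeasurableSet (U ∩ K) := hUo.measurableSet.inter hKm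
  have hμpos : 0 < μ (U ∩ K) := hfat U hUo hxU
  have hμtop : μ (U ∩ K) < ⊤ := (measure_mono inter_subset_right).trans_lt hK.measure_lt_top
  have hreal : 0 < μ.real (U ∩ K) := ENNReal.toReal_pos hμpos.ne' hμtop.ne
  refine ⟨m * μ.real (U ∩ K), mul_pos hm0 hreal, fun n => ?_⟩
  have hint : IntegrableOn (fun x => g x ^ n * w x) K μ :=
    ((hg.pow n).mul hw).integrableOn_compact' hK hKm
  -- `∫_K gⁿ w ≥ ∫_{U ∩ K} gⁿ w ≥ ∫_{U ∩ K} cⁿ m`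
  have h1 : ∫ x in U ∩ K, g x ^ n * w x ∂μ ≤ ∫ x in K, g x ^ n * w x ∂μ := by
    refine setIntegral_mono_set hint ?_ (Eventually.of_forall inter_subset_right)
    filter_upwards [ae_restrict_mem hKm] with x hx
    exact mul_nonneg (pow_nonneg (hg0 x hx) n) (hw0 x hx).le
  have h2 : ∫ x in U ∩ K, c ^ n * m ∂μ ≤ ∫ x in U ∩ K, g x ^ n * w x ∂μ := by
    refine setIntegral_mono_on ?_ (hint.mono_set inter_subset_right) hUKm ?_
    · exact (integrableOn_const_iff (C := c ^ n * m)).2 (Or.inr hμtop)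
    · intro x hx
      have hxK : x ∈ K := hx.2
      have hcg : c ≤ g x := le_of_lt (hUK hx)
      exact mul_le_mul (pow_le_pow_left₀ hc.le hcg n) (hmin hxK) hm0.le (pow_nonneg (hg0 x hxK) n)
  have h3 : ∫ x in U ∩ K, c ^ n * m ∂μ = μ.real (U ∩ K) * (c ^ n * m) := by
    rw [setIntegral_const, smul_eq_mul]
  calc m * μ.real (U ∩ K) * c ^ n = μ.real (U ∩ K) * (c ^ n * m) := by ring
    _ = ∫ x in U ∩ K, c ^ n * m ∂μ := h3.symm
    _ ≤ ∫ x in K, g x ^ n * w x ∂μ := h2.trans h1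

/-- **Upper bound of the elementary Laplace method**: `∫_K gⁿ w ≤ (g x₀)ⁿ ∫_K w` when `0 ≤ g ≤ g x₀` and
`0 ≤ w` on `K`. [folklore] -/
theorem setIntegral_pow_mul_le (hK : IsCompact K) (hKm : MeasurableSet K) (hg : ContinuousOn g K)
    (hw : ContinuousOn w K) (hg0 : ∀ x ∈ K, 0 ≤ g x) (hw0 : ∀ x ∈ K, 0 ≤ w x)
    (hmax : ∀ x ∈ K, g x ≤ g x₀) (n : ℕ) :
    ∫ x in K, g x ^ n * w x ∂μ ≤ g x₀ ^ n * ∫ x in K, w x ∂μ := by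
  have hint : IntegrableOn (fun x => g x ^ n * w x) K μ :=
    ((hg.pow n).mul hw).integrableOn_compact' hK hKm
  have hwint : IntegrableOn w K μ := hw.integrableOn_compact' hK hKm
  rw [← integral_const_mul]
  refine setIntegral_mono_on hint (hwint.const_mul _) hKm fun x hx => ?_
  exact mul_le_mul_of_nonneg_right (pow_le_pow_left₀ (hg0 x hx) (hmax x hx) n) (hw0 x hx)

/-- **The elementary Laplace method (exponential rate).** `K` compact measurable in a topological measure
space with `μ` finite on compacts; `g, w` continuous on `K`, `g ≥ 0`, `w > 0` on `K`; `x₀ ∈ K` a maximum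
point of `g|_K` with `g x₀ > 0`, every open neighbourhood `U` of which has `μ(U ∩ K) > 0`. Then
`(1/n) log ∫_K gⁿ w dμ → log g(x₀)`. (de Bruijn, Ch. 4; the form "`lim (1/n) log ∫∫ … = log max`" used in
Viola–Zudilin 2018, (4.12).) [folklore] -/
theorem tendsto_log_setIntegral_pow_mul_div (hK : IsCompact K) (hKm : MeasurableSet K)
    (hg : ContinuousOn g K) (hw : ContinuousOn w K) (hg0 : ∀ x ∈ K, 0 ≤ g x) (hw0 : ∀ x ∈ K, 0 < w x)
    (hx₀ : x₀ ∈ K) (hmax : ∀ x ∈ K, g x ≤ g x₀) (hM : 0 < g x₀)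
    (hfat : ∀ U : Set X, IsOpen U → x₀ ∈ U → 0 < μ (U ∩ K)) :
    Tendsto (fun n : ℕ => Real.log (∫ x in K, g x ^ n * w x ∂μ) / n) atTop (𝓝 (Real.log (g x₀))) := by
  set M := g x₀ with hMdef
  set I : ℕ → ℝ := fun n => ∫ x in K, g x ^ n * w x ∂μ with hI
  set W : ℝ := ∫ x in K, w x ∂μ with hW
  -- lower bounds `C_c cⁿ ≤ I n`, in particular `I n > 0` and `W = I 0 > 0`
  have hlow : ∀ c : ℝ, 0 < c → c < M → ∃ C : ℝ, 0 < C ∧ ∀ n : ℕ, C * c ^ n ≤ I n := fun c hc hcM =>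
    exists_pos_mul_pow_le_setIntegral_pow_mul hK hKm hg hw hg0 hw0 hx₀ hfat hc hcM
  obtain ⟨C₀, hC₀, hC₀le⟩ := hlow (M / 2) (half_pos hM) (half_lt_self hM)
  have hIpos : ∀ n, 0 < I n := fun n =>
    (mul_pos hC₀ (pow_pos (half_pos hM) n)).trans_le (hC₀le n)
  have hW0 : 0 < W := by
    have h := hIpos 0
    simp only [hI, pow_zero, one_mul] at h
    exact h
  -- upper bound `I n ≤ Mⁿ W`
  have hup : ∀ n, I n ≤ M ^ n * W := fun n =>
    setIntegral_pow_mul_le hK hKm hg hw hg0 (fun x hx => (hw0 x hx).le) hmax n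
  have hdiv0 : ∀ L : ℝ, Tendsto (fun n : ℕ => L / (n : ℝ)) atTop (𝓝 0) := fun L =>
    tendsto_const_div_atTop_nhds_zero_nat L
  rw [tendsto_order]
  refine ⟨fun a ha => ?_, fun b hb => ?_⟩
  · -- lower: `a < log M`; take `log c = (a + log M)/2`
    set c := Real.exp ((a + Real.log M) / 2) with hc
    have hc0 : 0 < c := Real.exp_pos _
    have hcM : c < M := by
      calc c < Real.exp (Real.log M) := Real.exp_lt_exp.2 (by linarith)
        _ = M := Real.exp_log hM
    have hlogc : a < Real.log c := by rw [hc, Real.log_exp]; linarith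
    obtain ⟨C, hC, hCle⟩ := hlow c hc0 hcM
    have hlim : Tendsto (fun n : ℕ => Real.log c + Real.log C / (n : ℝ)) atTop (𝓝 (Real.log c)) := by
      simpa using tendsto_const_nhds.add (hdiv0 (Real.log C))
    filter_upwards [hlim.eventually_const_lt hlogc, eventually_ge_atTop 1] with n hn hn1
    have hnpos : (0 : ℝ) < n := by exact_mod_cast hn1
    have hlogI : n * Real.log c + Real.log C ≤ Real.log (I n) := by
      have h := Real.log_le_log (mul_pos hC (pow_pos hc0 n)) (hCle n)
      rwa [Real.log_mul hC.ne' (pow_pos hc0 n).ne', Real.log_pow, add_comm] at h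
    calc a < Real.log c + Real.log C / n := hn
      _ = (n * Real.log c + Real.log C) / n := by field_simp
      _ ≤ Real.log (I n) / n := div_le_div_of_nonneg_right hlogI hnpos.le
  · -- upper: `log M < b`
    have hlim : Tendsto (fun n : ℕ => Real.log M + Real.log W / (n : ℝ)) atTop (𝓝 (Real.log M)) := by
      simpa using tendsto_const_nhds.add (hdiv0 (Real.log W))
    filter_upwards [hlim.eventually_lt_const hb, eventually_ge_atTop 1] with n hn hn1
    have hnpos : (0 : ℝ) < n := by exact_mod_cast hn1
    have hlogI : Real.log (I n) ≤ n * Real.log M + Real.log W := by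
      have h := Real.log_le_log (hIpos n) (hup n)
      rwa [Real.log_mul (pow_pos hM n).ne' hW0.ne', Real.log_pow] at h
    calc Real.log (I n) / n ≤ (n * Real.log M + Real.log W) / n := div_le_div_of_nonneg_right hlogI hnpos.le
      _ = Real.log M + Real.log W / n := by field_simp
      _ < b := hn

/-! ### From the logarithmic rate to two-sided exponential bounds -/

/-- **Exponential bounds from the logarithmic rate**: if `I_n > 0` and `(1/n) log I_n → L`, then for every
`ε > 0`, `e^{(L−ε)n} ≤ I_n ≤ e^{(L+ε)n}` for all large `n` — the form in which linear-independence criteria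
(Nesterenko's, or Viola–Zudilin's Lemma 5.1) consume the asymptotics of the approximating forms.
[folklore] -/
theorem eventually_exp_mul_le_and_le_exp_mul {I : ℕ → ℝ} {L : ℝ} (hI : ∀ n, 0 < I n)
    (h : Tendsto (fun n : ℕ => Real.log (I n) / n) atTop (𝓝 L)) {ε : ℝ} (hε : 0 < ε) :
    ∀ᶠ n : ℕ in atTop, Real.exp ((L - ε) * n) ≤ I n ∧ I n ≤ Real.exp ((L + ε) * n) := by
  filter_upwards [h.eventually_const_lt (show L - ε < L by linarith),
    h.eventually_lt_const (show L < L + ε by linarith), eventually_ge_atTop 1] with n hlo hhi hn1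
  have hn : (0 : ℝ) < n := by exact_mod_cast hn1
  rw [lt_div_iff₀ hn] at hlo
  rw [div_lt_iff₀ hn] at hhi
  constructor
  · rw [← Real.log_le_log_iff (Real.exp_pos _) (hI n), Real.log_exp]
    exact hlo.le
  · rw [← Real.log_le_log_iff (hI n) (Real.exp_pos _), Real.log_exp]
    exact hhi.le

/-- The elementary Laplace method in exponential form: under the hypotheses of
`tendsto_log_setIntegral_pow_mul_div`, for every `ε > 0`,
`(g x₀)ⁿ e^{−εn} ≤ ∫_K gⁿ w dμ ≤ (g x₀)ⁿ e^{εn}` for all large `n`. [folklore] -/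
theorem eventually_setIntegral_pow_mul_bounds (hK : IsCompact K) (hKm : MeasurableSet K)
    (hg : ContinuousOn g K) (hw : ContinuousOn w K) (hg0 : ∀ x ∈ K, 0 ≤ g x) (hw0 : ∀ x ∈ K, 0 < w x)
    (hx₀ : x₀ ∈ K) (hmax : ∀ x ∈ K, g x ≤ g x₀) (hM : 0 < g x₀)
    (hfat : ∀ U : Set X, IsOpen U → x₀ ∈ U → 0 < μ (U ∩ K)) {ε : ℝ} (hε : 0 < ε) :
    ∀ᶠ n : ℕ in atTop, g x₀ ^ n * Real.exp (-(ε * n)) ≤ ∫ x in K, g x ^ n * w x ∂μ ∧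
      ∫ x in K, g x ^ n * w x ∂μ ≤ g x₀ ^ n * Real.exp (ε * n) := by
  have hpos : ∀ n, 0 < ∫ x in K, g x ^ n * w x ∂μ := by
    intro n
    obtain ⟨C, hC, hCle⟩ := exists_pos_mul_pow_le_setIntegral_pow_mul hK hKm hg hw hg0 hw0 hx₀ hfat
      (half_pos hM) (half_lt_self hM)
    exact (mul_pos hC (pow_pos (half_pos hM) n)).trans_le (hCle n)
  have h := eventually_exp_mul_le_and_le_exp_mul hpos
    (tendsto_log_setIntegral_pow_mul_div hK hKm hg hw hg0 hw0 hx₀ hmax hM hfat) hε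
  filter_upwards [h] with n hn
  have e1 : Real.exp ((Real.log (g x₀) - ε) * n) = g x₀ ^ n * Real.exp (-(ε * n)) := by
    rw [sub_mul, Real.exp_sub, mul_comm (Real.log _), Real.exp_nat_mul, Real.exp_log hM,
      Real.exp_neg, div_eq_mul_inv]
  have e2 : Real.exp ((Real.log (g x₀) + ε) * n) = g x₀ ^ n * Real.exp (ε * n) := by
    rw [add_mul, Real.exp_add, mul_comm (Real.log _), Real.exp_nat_mul, Real.exp_log hM]
  rw [e1, e2] at hn
  exact hn

/-! ### Singular weights (integrable, continuous and positive only near the maximum point) -/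

/-- **Lower bound, integrable weight.** As `exists_pos_mul_pow_le_setIntegral_pow_mul`, but the weight `w`
is only assumed integrable and non-negative on `K`, and continuous within `K` at `x₀` with `w x₀ > 0`
(the weights `1/(x(1−y)+yz)` of Rhin–Viola / Viola–Zudilin double integrals blow up at a corner of the
square). [folklore] -/
theorem exists_pos_mul_pow_le_setIntegral_pow_mul_of_integrableOn (hK : IsCompact K)
    (hKm : MeasurableSet K) (hg : ContinuousOn g K) (hwK : IntegrableOn w K μ) (hg0 : ∀ x ∈ K, 0 ≤ g x)
    (hw0 : ∀ x ∈ K, 0 ≤ w x) (hx₀ : x₀ ∈ K) (hwx₀ : ContinuousWithinAt w K x₀) (hwpos : 0 < w x₀)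
    (hfat : ∀ U : Set X, IsOpen U → x₀ ∈ U → 0 < μ (U ∩ K)) {c : ℝ} (hc : 0 < c) (hcM : c < g x₀) :
    ∃ C : ℝ, 0 < C ∧ ∀ n : ℕ, C * c ^ n ≤ ∫ x in K, g x ^ n * w x ∂μ := by
  set m := w x₀ / 2 with hm
  have hm0 : 0 < m := half_pos hwpos
  -- open `U ∋ x₀` with `g > c` and `w > m` on `U ∩ K`
  have hng : g ⁻¹' Ioi c ∈ 𝓝[K] x₀ := (hg x₀ hx₀).preimage_mem_nhdsWithin (Ioi_mem_nhds hcM)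
  have hnw : w ⁻¹' Ioi m ∈ 𝓝[K] x₀ :=
    hwx₀.preimage_mem_nhdsWithin (Ioi_mem_nhds (by simp only [hm]; linarith))
  obtain ⟨U, hUo, hxU, hUK⟩ := mem_nhdsWithin.1 (Filter.inter_mem hng hnw)
  have hUKm : MeasurableSet (U ∩ K) := hUo.measurableSet.inter hKm
  have hμpos : 0 < μ (U ∩ K) := hfat U hUo hxU
  have hμtop : μ (U ∩ K) < ⊤ := (measure_mono inter_subset_right).trans_lt hK.measure_lt_top
  have hreal : 0 < μ.real (U ∩ K) := ENNReal.toReal_pos hμpos.ne' hμtop.ne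
  refine ⟨m * μ.real (U ∩ K), mul_pos hm0 hreal, fun n => ?_⟩
  have hint : IntegrableOn (fun x => g x ^ n * w x) K μ :=
    hwK.continuousOn_mul_of_subset (hg.pow n) hK hKm Subset.rfl
  have h1 : ∫ x in U ∩ K, g x ^ n * w x ∂μ ≤ ∫ x in K, g x ^ n * w x ∂μ := by
    refine setIntegral_mono_set hint ?_ (Eventually.of_forall inter_subset_right)
    filter_upwards [ae_restrict_mem hKm] with x hx
    exact mul_nonneg (pow_nonneg (hg0 x hx) n) (hw0 x hx)
  have h2 : ∫ x in U ∩ K, c ^ n * m ∂μ ≤ ∫ x in U ∩ K, g x ^ n * w x ∂μ := by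
    refine setIntegral_mono_on ?_ (hint.mono_set inter_subset_right) hUKm ?_
    · exact (integrableOn_const_iff (C := c ^ n * m)).2 (Or.inr hμtop)
    · intro x hx
      have hxK : x ∈ K := hx.2
      have hgw := hUK hx
      have hcg : c ≤ g x := le_of_lt hgw.1
      have hmw : m ≤ w x := le_of_lt hgw.2
      exact mul_le_mul (pow_le_pow_left₀ hc.le hcg n) hmw hm0.le (pow_nonneg (hg0 x hxK) n)
  have h3 : ∫ x in U ∩ K, c ^ n * m ∂μ = μ.real (U ∩ K) * (c ^ n * m) := by
    rw [setIntegral_const, smul_eq_mul]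
  calc m * μ.real (U ∩ K) * c ^ n = μ.real (U ∩ K) * (c ^ n * m) := by ring
    _ = ∫ x in U ∩ K, c ^ n * m ∂μ := h3.symm
    _ ≤ ∫ x in K, g x ^ n * w x ∂μ := h2.trans h1

/-- **The elementary Laplace method with an integrable weight**: `K` compact measurable, `g` continuous
on `K` with `0 ≤ g ≤ g x₀`, `g x₀ > 0`, fat neighbourhoods of `x₀` in `K`; `w ≥ 0` integrable on `K`,
continuous within `K` at `x₀` with `w x₀ > 0`. Then `(1/n) log ∫_K gⁿ w dμ → log g(x₀)` (same proof as
`tendsto_log_setIntegral_pow_mul_div`; this is the form needed for the Viola–Zudilin integrals `J_z^{(0)}`,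
whose weight `1/(x(1−y)+yz)` is singular at the corner `(0,0)` where `g = 0`). [folklore] -/
theorem tendsto_log_setIntegral_pow_mul_div_of_integrableOn (hK : IsCompact K) (hKm : MeasurableSet K)
    (hg : ContinuousOn g K) (hwK : IntegrableOn w K μ) (hg0 : ∀ x ∈ K, 0 ≤ g x)
    (hw0 : ∀ x ∈ K, 0 ≤ w x) (hx₀ : x₀ ∈ K) (hwx₀ : ContinuousWithinAt w K x₀) (hwpos : 0 < w x₀)
    (hmax : ∀ x ∈ K, g x ≤ g x₀) (hM : 0 < g x₀)
    (hfat : ∀ U : Set X, IsOpen U → x₀ ∈ U → 0 < μ (U ∩ K)) :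
    Tendsto (fun n : ℕ => Real.log (∫ x in K, g x ^ n * w x ∂μ) / n) atTop (𝓝 (Real.log (g x₀))) := by
  set M := g x₀ with hMdef
  set I : ℕ → ℝ := fun n => ∫ x in K, g x ^ n * w x ∂μ with hI
  set W : ℝ := ∫ x in K, w x ∂μ with hW
  have hlow : ∀ c : ℝ, 0 < c → c < M → ∃ C : ℝ, 0 < C ∧ ∀ n : ℕ, C * c ^ n ≤ I n := fun c hc hcM =>
    exists_pos_mul_pow_le_setIntegral_pow_mul_of_integrableOn hK hKm hg hwK hg0 hw0 hx₀ hwx₀ hwpos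
      hfat hc hcM
  obtain ⟨C₀, hC₀, hC₀le⟩ := hlow (M / 2) (half_pos hM) (half_lt_self hM)
  have hIpos : ∀ n, 0 < I n := fun n =>
    (mul_pos hC₀ (pow_pos (half_pos hM) n)).trans_le (hC₀le n)
  have hW0 : 0 < W := by
    have h := hIpos 0
    simp only [hI, pow_zero, one_mul] at h
    exact h
  -- upper bound `I n ≤ Mⁿ W`
  have hup : ∀ n, I n ≤ M ^ n * W := by
    intro n
    have hint : IntegrableOn (fun x => g x ^ n * w x) K μ :=
      hwK.continuousOn_mul_of_subset (hg.pow n) hK hKm Subset.rfl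
    simp only [hI, hW]
    rw [← integral_const_mul]
    refine setIntegral_mono_on hint (hwK.const_mul _) hKm fun x hx => ?_
    exact mul_le_mul_of_nonneg_right (pow_le_pow_left₀ (hg0 x hx) (hmax x hx) n) (hw0 x hx)
  have hdiv0 : ∀ L : ℝ, Tendsto (fun n : ℕ => L / (n : ℝ)) atTop (𝓝 0) := fun L =>
    tendsto_const_div_atTop_nhds_zero_nat L
  rw [tendsto_order]
  refine ⟨fun a ha => ?_, fun b hb => ?_⟩
  · set c := Real.exp ((a + Real.log M) / 2) with hc
    have hc0 : 0 < c := Real.exp_pos _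
    have hcM : c < M := by
      calc c < Real.exp (Real.log M) := Real.exp_lt_exp.2 (by linarith)
        _ = M := Real.exp_log hM
    have hlogc : a < Real.log c := by rw [hc, Real.log_exp]; linarith
    obtain ⟨C, hC, hCle⟩ := hlow c hc0 hcM
    have hlim : Tendsto (fun n : ℕ => Real.log c + Real.log C / (n : ℝ)) atTop (𝓝 (Real.log c)) := by
      simpa using tendsto_const_nhds.add (hdiv0 (Real.log C))
    filter_upwards [hlim.eventually_const_lt hlogc, eventually_ge_atTop 1] with n hn hn1
    have hnpos : (0 : ℝ) < n := by exact_mod_cast hn1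
    have hlogI : n * Real.log c + Real.log C ≤ Real.log (I n) := by
      have h := Real.log_le_log (mul_pos hC (pow_pos hc0 n)) (hCle n)
      rwa [Real.log_mul hC.ne' (pow_pos hc0 n).ne', Real.log_pow, add_comm] at h
    calc a < Real.log c + Real.log C / n := hn
      _ = (n * Real.log c + Real.log C) / n := by field_simp
      _ ≤ Real.log (I n) / n := div_le_div_of_nonneg_right hlogI hnpos.le
  · have hlim : Tendsto (fun n : ℕ => Real.log M + Real.log W / (n : ℝ)) atTop (𝓝 (Real.log M)) := by
      simpa using tendsto_const_nhds.add (hdiv0 (Real.log W))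
    filter_upwards [hlim.eventually_lt_const hb, eventually_ge_atTop 1] with n hn hn1
    have hnpos : (0 : ℝ) < n := by exact_mod_cast hn1
    have hlogI : Real.log (I n) ≤ n * Real.log M + Real.log W := by
      have h := Real.log_le_log (hIpos n) (hup n)
      rwa [Real.log_mul (pow_pos hM n).ne' hW0.ne', Real.log_pow] at h
    calc Real.log (I n) / n ≤ (n * Real.log M + Real.log W) / n := div_le_div_of_nonneg_right hlogI hnpos.le
      _ = Real.log M + Real.log W / n := by field_simp
      _ < b := hn

omit [OpensMeasurableSpace X] [IsFiniteMeasureOnCompacts μ] in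
/-- The fatness hypothesis holds at interior points for measures positive on open sets: if
`x₀ ∈ interior K` and `μ` is positive on non-empty open sets then `μ(U ∩ K) > 0` for every open `U ∋ x₀`.
[folklore] -/
theorem measure_inter_pos_of_mem_interior [μ.IsOpenPosMeasure] (hx₀ : x₀ ∈ interior K) {U : Set X}
    (hU : IsOpen U) (hxU : x₀ ∈ U) : 0 < μ (U ∩ K) := by
  have hsub : U ∩ interior K ⊆ U ∩ K := inter_subset_inter_right _ interior_subset
  refine lt_of_lt_of_le ?_ (measure_mono hsub)
  exact (hU.inter isOpen_interior).measure_pos μ ⟨x₀, hxU, hx₀⟩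

end LaplaceSupNorm

end Literature.Analysis.Asymptotics

end
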